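import Summits.CriticalPhenomena.PercolationContinuityZ3.Theorems.PercNearOneGluingAdditiveGluingGDMExchangeReduction
import Summits.CriticalPhenomena.PercolationContinuityZ3.Theorems.PercNearOneGluingAdditiveGluingEdgeSwitch
import HarnessLib

/-! # Crux `PercNearOneGluing.AdditiveGluing` (stmt-CriticalPhenomena-4576) — reduction of the crux to a certificate on the
# refined glued-dominant-minimiser class CUT DOWN BY THE SINGLE-EDGE SWITCH (exchange-certificate form, seat (d) round 4)

Support file (`--supports stmt-CriticalPhenomena-4576`); no definitions, no named facts.  CONDITIONAL result (hypothesis spelled out).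

The block kernel `BG(u,S,a₀)` (block goodness of `S` at the un-glued minimiser `a₀`, worst selection) is proved by a DOUBLE
induction: the outer induction hypothesis `HBLK` (every weighting with fewer positive-degree vertices; handed in by the landed
assembly `stub_cone7Assembly_c5`) and an INNER strong induction on the number of positive-weight pairs, which makes the
single-edge switch `blockGood_of_edgeSwitch` available: for every block edge `e = s(x,y)` (`x ∈ S ∌ y`, `u e ≠ 0`) and every
minimiser `d` of `μ_{u[e↦0]}(· ↔ b)` over `A`, the block `S` is `a₀`-good as soon as `τ_{u/S}(a₀) ≤ τ_{u/S}(d)`.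
So the certificate (single-competitor exchange form `∃ a, V_a ≥ 0`, as in `cone7_of_gdmExch`) is only needed on the class
  isolated ✗ · `A.card ≤ 3` ✗ · leaf ✗ · pinned leaf ✗ · switch ✗ · pinned switch ✗ · **edge switch ✗**
("every single-edge deletion dethrones `a₀` in the glued order").  Census of this seat (exact engine, lab/t1): the edge switch
closes all 22 records of the refined class found by kit job j034795, each time with `d = a₀` itself.
`additiveGluing_of_edgeCert : EDGECERT → AdditiveGluing` (crux statement unfolded).  [cite: KozmaNitzan2024, §3.2 pp. 12–14, §5.3 p. 34]
-/

namespace Summit.CriticalPhenomena.PercolationContinuityZ3.Theorems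

open MeasureTheory Set
open Literature.Probability.LatticeModels (prodBernoulli)
open Literature.Probability.Percolation (BondConfig openConn openConnIn openGraph openCluster)
open scoped BigOperators

noncomputable section
open Classical

section EdgeSwitchReduction

open Literature.Probability.LatticeModels Literature.Probability.Percolation

variable {n : ℕ}

/-- Deleting a positive pair strictly decreases the number of positive pairs. [folklore] -/
theorem edgeSw_card_posPairs_lt (u : Sym2 (Fin n) → unitInterval) (e : Sym2 (Fin n)) (he : (u e : ℝ) ≠ 0) :
    (Finset.univ.filter (fun e' : Sym2 (Fin n) => 0 < (Function.update u e 0 e' : ℝ))).card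
      < (Finset.univ.filter (fun e' : Sym2 (Fin n) => 0 < (u e' : ℝ))).card := by
  refine Finset.card_lt_card ⟨fun e' he' => ?_, fun hsub => ?_⟩
  · have h := (Finset.mem_filter.1 he').2
    by_cases hee : e' = e
    · subst hee
      simp only [Function.update_self] at h
      exact absurd h (by norm_num)
    · rw [Function.update_of_ne hee] at h
      exact Finset.mem_filter.2 ⟨Finset.mem_univ _, h⟩
  · have hmem : e ∈ Finset.univ.filter (fun e' : Sym2 (Fin n) => 0 < (u e' : ℝ)) :=
      Finset.mem_filter.2 ⟨Finset.mem_univ _, lt_of_le_of_ne (u e).2.1 (Ne.symm he)⟩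
    have h := (Finset.mem_filter.1 (hsub hmem)).2
    simp only [Function.update_self] at h
    exact absurd h (by norm_num)

/-- Deleting a pair does not increase the number of positive-degree vertices. [folklore] -/
theorem edgeSw_card_posDeg_le (u : Sym2 (Fin n) → unitInterval) (e : Sym2 (Fin n)) :
    (Finset.univ.filter (fun v : Fin n => ∃ y : Fin n, 0 < (Function.update u e 0 s(y, v) : ℝ))).card
      ≤ (Finset.univ.filter (fun v : Fin n => ∃ y : Fin n, 0 < (u s(y, v) : ℝ))).card := by
  refine Finset.card_le_card fun v hv => ?_
  obtain ⟨y, hy⟩ := (Finset.mem_filter.1 hv).2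
  refine Finset.mem_filter.2 ⟨Finset.mem_univ _, y, ?_⟩
  by_cases hee : s(y, v) = e
  · rw [hee, Function.update_self] at hy
    exact absurd hy (by norm_num)
  · rwa [Function.update_of_ne hee] at hy

/-- **The cone statement from a certificate on the refined GDM class cut down by the single-edge switch** (outer hypothesis
`HBLK` + inner strong induction on the number of positive pairs).  [cite: KozmaNitzan2024, §3.2 Thms 4–5 pp. 12–14, Lemma 3 pp. 6–7, §5.3 p. 34] -/
theorem cone7_of_edgeCert
    (hG : (∀ (n : ℕ) (u : Sym2 (Fin n) → unitInterval) (A S : Finset (Fin n)) (b a₀ : Fin n) (hb : b ∈ A),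
      Disjoint S A → a₀ ∈ A →
      (∀ a ∈ A, (prodBernoulli u).real (openConn a₀ b) ≤ (prodBernoulli u).real (openConn a b)) →
      (∀ w' : Sym2 (Fin n) → unitInterval,
        (Finset.univ.filter (fun v : Fin n => ∃ y : Fin n, 0 < (w' s(y, v) : ℝ))).card
          < (Finset.univ.filter (fun v : Fin n => ∃ y : Fin n, 0 < (u s(y, v) : ℝ))).card →
        ∀ (A' S' : Finset (Fin n)) (b' d' : Fin n) (hb' : b' ∈ A'), Disjoint S' A' → d' ∈ A' →
        (∀ a ∈ A', (prodBernoulli w').real (openConn d' b') ≤ (prodBernoulli w').real (openConn a b')) →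
        (prodBernoulli w').real (openConn d' b')
          + (prodBernoulli w').real
              ((openConn d' b')ᶜ ∩ (⋃ v ∈ S', openConn d' v) ∩ (⋃ v ∈ S', openConn v b'))
        ≤ (prodBernoulli w').real (⋃ v ∈ S', openConn v b')
          + (∑ W ∈ (Finset.univ : Finset (Finset (Fin n))).filter (fun W => Disjoint W A'),
              (prodBernoulli w').real
                  {ω : BondConfig (Fin n) | ∀ z : Fin n, (z ∈ W ↔ ω ∈ ⋃ v ∈ S', openConn v z)}
                * A'.inf' ⟨b', hb'⟩ (fun a => (prodBernoulli w').real (openConnIn ((W : Set (Fin n))ᶜ) a b')))) →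
      4 ≤ A.card →
      (∃ x ∈ S, ∃ y : Fin n, (u s(x, y) : ℝ) ≠ 0) →
      (∀ v ∈ S, (prodBernoulli u).real (openConn v b) < (prodBernoulli u).real (openConn a₀ b)) →
      (∀ v ∈ S, (prodBernoulli (fun e : Sym2 (Fin n) => if a₀ ∈ e ∧ (∃ y ∈ e, y ∈ S) then (0 : unitInterval) else u e)).real (openConn v b) < (prodBernoulli (fun e : Sym2 (Fin n) => if a₀ ∈ e ∧ (∃ y ∈ e, y ∈ S) then (0 : unitInterval) else u e)).real (openConn a₀ b)) →
      (∀ x' ∈ S, (∃ y : Fin n, (u s(x', y) : ℝ) ≠ 0) → ∀ dd ∈ A,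
        (∀ a ∈ A, (prodBernoulli (fun e : Sym2 (Fin n) => if (∃ y ∈ e, y ∈ ({x'} : Finset (Fin n))) then (0 : unitInterval) else u e)).real (openConn dd b) ≤ (prodBernoulli (fun e : Sym2 (Fin n) => if (∃ y ∈ e, y ∈ ({x'} : Finset (Fin n))) then (0 : unitInterval) else u e)).real (openConn a b)) →
        (prodBernoulli (fun e : Sym2 (Fin n) => if (∀ y ∈ e, y ∈ S) ∧ ¬ e.IsDiag then 1 else u e)).real (openConn dd b) < (prodBernoulli (fun e : Sym2 (Fin n) => if (∀ y ∈ e, y ∈ S) ∧ ¬ e.IsDiag then 1 else u e)).real (openConn a₀ b)) →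
      (∀ x' ∈ S, (∃ y : Fin n, ((fun e : Sym2 (Fin n) => if a₀ ∈ e ∧ (∃ y ∈ e, y ∈ S) then (0 : unitInterval) else u e) s(x', y) : ℝ) ≠ 0) → ∀ dd ∈ A,
        (∀ a ∈ A, (prodBernoulli (fun e : Sym2 (Fin n) => if (∃ y ∈ e, y ∈ ({x'} : Finset (Fin n))) then (0 : unitInterval) else (fun e : Sym2 (Fin n) => if a₀ ∈ e ∧ (∃ y ∈ e, y ∈ S) then (0 : unitInterval) else u e) e)).real (openConn dd b) ≤ (prodBernoulli (fun e : Sym2 (Fin n) => if (∃ y ∈ e, y ∈ ({x'} : Finset (Fin n))) then (0 : unitInterval) else (fun e : Sym2 (Fin n) => if a₀ ∈ e ∧ (∃ y ∈ e, y ∈ S) then (0 : unitInterval) else u e) e)).real (openConn a b)) →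
        (prodBernoulli (fun e : Sym2 (Fin n) => if (∀ y ∈ e, y ∈ S) ∧ ¬ e.IsDiag then 1 else (fun e : Sym2 (Fin n) => if a₀ ∈ e ∧ (∃ y ∈ e, y ∈ S) then (0 : unitInterval) else u e) e)).real (openConn dd b) < (prodBernoulli (fun e : Sym2 (Fin n) => if (∀ y ∈ e, y ∈ S) ∧ ¬ e.IsDiag then 1 else (fun e : Sym2 (Fin n) => if a₀ ∈ e ∧ (∃ y ∈ e, y ∈ S) then (0 : unitInterval) else u e) e)).real (openConn a₀ b)) →
      -- NEW: every single-edge switch fails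
      (∀ x ∈ S, ∀ y : Fin n, y ∉ S → (u s(x, y) : ℝ) ≠ 0 → ∀ dd ∈ A,
        (∀ a ∈ A, (prodBernoulli (Function.update u s(x, y) 0)).real (openConn dd b) ≤ (prodBernoulli (Function.update u s(x, y) 0)).real (openConn a b)) →
        (prodBernoulli (fun e : Sym2 (Fin n) => if (∀ z ∈ e, z ∈ S) ∧ ¬ e.IsDiag then 1 else u e)).real (openConn dd b) < (prodBernoulli (fun e : Sym2 (Fin n) => if (∀ z ∈ e, z ∈ S) ∧ ¬ e.IsDiag then 1 else u e)).real (openConn a₀ b)) →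
      ∃ a ∈ A, (prodBernoulli u).real (openConn a b ∩ (⋃ s ∈ S, openConn a₀ s)ᶜ)
      ≤ (prodBernoulli u).real ((⋃ s ∈ S, openConn s b) ∩ (⋃ s ∈ S, openConn a₀ s)ᶜ)
        + ∑ W ∈ (Finset.univ : Finset (Finset (Fin n))).filter (fun W => Disjoint W A),
            (prodBernoulli u).real {ω : BondConfig (Fin n) | ∀ z : Fin n, (z ∈ W ↔ ω ∈ ⋃ s ∈ S, openConn s z)}
              * A.inf' ⟨b, hb⟩ (fun a' => (prodBernoulli u).real (openConnIn ((W : Set (Fin n))ᶜ) a' b)))) :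
    ∀ (n : ℕ) (u : Sym2 (Fin n) → unitInterval) (A S : Finset (Fin n)) (b a₀ : Fin n) (hb : b ∈ A),
      Disjoint S A → a₀ ∈ A →
      (∀ a ∈ A, (prodBernoulli u).real (openConn a₀ b) ≤ (prodBernoulli u).real (openConn a b)) →
      (∀ w' : Sym2 (Fin n) → unitInterval,
        (Finset.univ.filter (fun v : Fin n => ∃ y : Fin n, 0 < (w' s(y, v) : ℝ))).card
          < (Finset.univ.filter (fun v : Fin n => ∃ y : Fin n, 0 < (u s(y, v) : ℝ))).card →
        ∀ (A' S' : Finset (Fin n)) (b' d' : Fin n) (hb' : b' ∈ A'), Disjoint S' A' → d' ∈ A' →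
        (∀ a ∈ A', (prodBernoulli w').real (openConn d' b') ≤ (prodBernoulli w').real (openConn a b')) →
        (prodBernoulli w').real (openConn d' b')
          + (prodBernoulli w').real
              ((openConn d' b')ᶜ ∩ (⋃ v ∈ S', openConn d' v) ∩ (⋃ v ∈ S', openConn v b'))
        ≤ (prodBernoulli w').real (⋃ v ∈ S', openConn v b')
          + (∑ W ∈ (Finset.univ : Finset (Finset (Fin n))).filter (fun W => Disjoint W A'),
              (prodBernoulli w').real
                  {ω : BondConfig (Fin n) | ∀ z : Fin n, (z ∈ W ↔ ω ∈ ⋃ v ∈ S', openConn v z)}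
                * A'.inf' ⟨b', hb'⟩ (fun a => (prodBernoulli w').real (openConnIn ((W : Set (Fin n))ᶜ) a b')))) →
      (prodBernoulli u).real (openConn a₀ b)
          + (prodBernoulli u).real
              ((openConn a₀ b)ᶜ ∩ (⋃ v ∈ S, openConn a₀ v) ∩ (⋃ v ∈ S, openConn v b))
        ≤ (prodBernoulli u).real (⋃ v ∈ S, openConn v b)
          + (∑ W ∈ (Finset.univ : Finset (Finset (Fin n))).filter (fun W => Disjoint W A),
              (prodBernoulli u).real
                  {ω : BondConfig (Fin n) | ∀ z : Fin n, (z ∈ W ↔ ω ∈ ⋃ v ∈ S, openConn v z)}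
                * A.inf' ⟨b, hb⟩ (fun a => (prodBernoulli u).real (openConnIn ((W : Set (Fin n))ᶜ) a b))) := by
  intro n u
  -- inner strong induction on the number of positive pairs
  suffices H : ∀ (m : ℕ) (u : Sym2 (Fin n) → unitInterval),
      (Finset.univ.filter (fun e' : Sym2 (Fin n) => 0 < (u e' : ℝ))).card = m →
      ∀ (A S : Finset (Fin n)) (b a₀ : Fin n) (hb : b ∈ A),
      Disjoint S A → a₀ ∈ A →
      (∀ a ∈ A, (prodBernoulli u).real (openConn a₀ b) ≤ (prodBernoulli u).real (openConn a b)) →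
      (∀ w' : Sym2 (Fin n) → unitInterval,
        (Finset.univ.filter (fun v : Fin n => ∃ y : Fin n, 0 < (w' s(y, v) : ℝ))).card
          < (Finset.univ.filter (fun v : Fin n => ∃ y : Fin n, 0 < (u s(y, v) : ℝ))).card →
        ∀ (A' S' : Finset (Fin n)) (b' d' : Fin n) (hb' : b' ∈ A'), Disjoint S' A' → d' ∈ A' →
        (∀ a ∈ A', (prodBernoulli w').real (openConn d' b') ≤ (prodBernoulli w').real (openConn a b')) →
        (prodBernoulli w').real (openConn d' b')
          + (prodBernoulli w').real
              ((openConn d' b')ᶜ ∩ (⋃ v ∈ S', openConn d' v) ∩ (⋃ v ∈ S', openConn v b'))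
        ≤ (prodBernoulli w').real (⋃ v ∈ S', openConn v b')
          + (∑ W ∈ (Finset.univ : Finset (Finset (Fin n))).filter (fun W => Disjoint W A'),
              (prodBernoulli w').real
                  {ω : BondConfig (Fin n) | ∀ z : Fin n, (z ∈ W ↔ ω ∈ ⋃ v ∈ S', openConn v z)}
                * A'.inf' ⟨b', hb'⟩ (fun a => (prodBernoulli w').real (openConnIn ((W : Set (Fin n))ᶜ) a b')))) →
      (prodBernoulli u).real (openConn a₀ b)
          + (prodBernoulli u).real
              ((openConn a₀ b)ᶜ ∩ (⋃ v ∈ S, openConn a₀ v) ∩ (⋃ v ∈ S, openConn v b))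
        ≤ (prodBernoulli u).real (⋃ v ∈ S, openConn v b)
          + (∑ W ∈ (Finset.univ : Finset (Finset (Fin n))).filter (fun W => Disjoint W A),
              (prodBernoulli u).real
                  {ω : BondConfig (Fin n) | ∀ z : Fin n, (z ∈ W ↔ ω ∈ ⋃ v ∈ S, openConn v z)}
                * A.inf' ⟨b, hb⟩ (fun a => (prodBernoulli u).real (openConnIn ((W : Set (Fin n))ᶜ) a b))) from
    fun A S b a₀ hb => H _ u rfl A S b a₀ hb
  intro m
  induction m using Nat.strong_induction_on with
  | _ m ih =>
  intro u hm A S b a₀ hb hSA ha₀ hmin hblk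
  have hbS : b ∉ S := fun h => Finset.disjoint_left.1 hSA h hb
  -- isolated block
  by_cases hiso : ∀ v ∈ S, ∀ y : Fin n, (u s(y, v) : ℝ) = 0
  · exact stub_isolatedBlock_c5 n u A S b a₀ hb hSA ha₀ hmin hiso
  have hex : ∃ x ∈ S, ∃ y : Fin n, (u s(x, y) : ℝ) ≠ 0 := by
    push Not at hiso
    obtain ⟨v, hv, y, hy⟩ := hiso
    refine ⟨v, hv, y, ?_⟩
    rw [Sym2.eq_swap]
    exact hy
  have hSne : S.Nonempty := by
    obtain ⟨x, hx, -⟩ := hex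
    exact ⟨x, hx⟩
  -- at most two relays besides the target
  by_cases hA3 : A.card ≤ 3
  · exact blockGood_cardLeThree_inf u A S b a₀ hb ha₀ hA3 hSne hmin
  have hA4 : 4 ≤ A.card := by omega
  -- leaf
  by_cases hleaf : ∃ v ∈ S, (prodBernoulli u).real (openConn a₀ b) ≤ (prodBernoulli u).real (openConn v b)
  · obtain ⟨v, hv, hle⟩ := hleaf
    exact blockGood_of_leaf u A S b a₀ v hb hv hbS hle
  -- pinned leaf
  by_cases hpleaf : ∃ v ∈ S, (prodBernoulli (fun e : Sym2 (Fin n) => if a₀ ∈ e ∧ (∃ y ∈ e, y ∈ S) then (0 : unitInterval) else u e)).real (openConn a₀ b) ≤ (prodBernoulli (fun e : Sym2 (Fin n) => if a₀ ∈ e ∧ (∃ y ∈ e, y ∈ S) then (0 : unitInterval) else u e)).real (openConn v b)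
  · obtain ⟨v, hv, hle⟩ := hpleaf
    exact blockGood_of_pinnedLeaf u A S b a₀ v hb hSA ha₀ hv hle
  -- switch
  by_cases hsw : ∃ x' ∈ S, (∃ y : Fin n, (u s(x', y) : ℝ) ≠ 0) ∧ ∃ d ∈ A,
      (∀ a ∈ A, (prodBernoulli (fun e : Sym2 (Fin n) => if (∃ y ∈ e, y ∈ ({x'} : Finset (Fin n))) then (0 : unitInterval) else u e)).real (openConn d b) ≤ (prodBernoulli (fun e : Sym2 (Fin n) => if (∃ y ∈ e, y ∈ ({x'} : Finset (Fin n))) then (0 : unitInterval) else u e)).real (openConn a b)) ∧ (prodBernoulli (fun e : Sym2 (Fin n) => if (∀ y ∈ e, y ∈ S) ∧ ¬ e.IsDiag then 1 else u e)).real (openConn a₀ b) ≤ (prodBernoulli (fun e : Sym2 (Fin n) => if (∀ y ∈ e, y ∈ S) ∧ ¬ e.IsDiag then 1 else u e)).real (openConn d b)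
  · obtain ⟨x', hx', hy, d, hd, hdmin, hle⟩ := hsw
    exact blockGood_of_switch u A S b a₀ x' d hb hSA hx' hd hy hdmin hle hblk
  -- pinned switch
  by_cases hpsw : ∃ x' ∈ S, (∃ y : Fin n, ((fun e : Sym2 (Fin n) => if a₀ ∈ e ∧ (∃ y ∈ e, y ∈ S) then (0 : unitInterval) else u e) s(x', y) : ℝ) ≠ 0) ∧ ∃ d ∈ A,
      (∀ a ∈ A, (prodBernoulli (fun e : Sym2 (Fin n) => if (∃ y ∈ e, y ∈ ({x'} : Finset (Fin n))) then (0 : unitInterval) else (fun e : Sym2 (Fin n) => if a₀ ∈ e ∧ (∃ y ∈ e, y ∈ S) then (0 : unitInterval) else u e) e)).real (openConn d b) ≤ (prodBernoulli (fun e : Sym2 (Fin n) => if (∃ y ∈ e, y ∈ ({x'} : Finset (Fin n))) then (0 : unitInterval) else (fun e : Sym2 (Fin n) => if a₀ ∈ e ∧ (∃ y ∈ e, y ∈ S) then (0 : unitInterval) else u e) e)).real (openConn a b)) ∧ (prodBernoulli (fun e : Sym2 (Fin n) => if (∀ y ∈ e, y ∈ S) ∧ ¬ e.IsDiag then 1 else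 (fun e : Sym2 (Fin n) => if a₀ ∈ e ∧ (∃ y ∈ e, y ∈ S) then (0 : unitInterval) else u e) e)).real (openConn a₀ b) ≤ (prodBernoulli (fun e : Sym2 (Fin n) => if (∀ y ∈ e, y ∈ S) ∧ ¬ e.IsDiag then 1 else (fun e : Sym2 (Fin n) => if a₀ ∈ e ∧ (∃ y ∈ e, y ∈ S) then (0 : unitInterval) else u e) e)).real (openConn d b)
  · obtain ⟨x', hx', hy, d, hd, hdmin, hle⟩ := hpsw
    exact blockGood_of_pinnedSwitch u A S b a₀ x' d hb hSA ha₀ hx' hd hy hdmin hle hblk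
  -- NEW: the single-edge switch (inner induction hypothesis at `u[e↦0]`)
  by_cases hes : ∃ x ∈ S, ∃ y : Fin n, y ∉ S ∧ (u s(x, y) : ℝ) ≠ 0 ∧ ∃ dd ∈ A,
      (∀ a ∈ A, (prodBernoulli (Function.update u s(x, y) 0)).real (openConn dd b) ≤ (prodBernoulli (Function.update u s(x, y) 0)).real (openConn a b)) ∧
      (prodBernoulli (fun e : Sym2 (Fin n) => if (∀ z ∈ e, z ∈ S) ∧ ¬ e.IsDiag then 1 else u e)).real (openConn a₀ b) ≤ (prodBernoulli (fun e : Sym2 (Fin n) => if (∀ z ∈ e, z ∈ S) ∧ ¬ e.IsDiag then 1 else u e)).real (openConn dd b)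
  · obtain ⟨x, hx, y, hyS, hne, dd, hdd, hddmin, hle⟩ := hes
    have hlt := edgeSw_card_posPairs_lt u s(x, y) hne
    rw [hm] at hlt
    have hblk0 : ∀ w' : Sym2 (Fin n) → unitInterval,
        (Finset.univ.filter (fun v : Fin n => ∃ y : Fin n, 0 < (w' s(y, v) : ℝ))).card
          < (Finset.univ.filter (fun v : Fin n => ∃ y' : Fin n, 0 < (Function.update u s(x, y) 0 s(y', v) : ℝ))).card →
        ∀ (A' S' : Finset (Fin n)) (b' d' : Fin n) (hb' : b' ∈ A'), Disjoint S' A' → d' ∈ A' →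
        (∀ a ∈ A', (prodBernoulli w').real (openConn d' b') ≤ (prodBernoulli w').real (openConn a b')) →
        (prodBernoulli w').real (openConn d' b')
          + (prodBernoulli w').real
              ((openConn d' b')ᶜ ∩ (⋃ v ∈ S', openConn d' v) ∩ (⋃ v ∈ S', openConn v b'))
        ≤ (prodBernoulli w').real (⋃ v ∈ S', openConn v b')
          + (∑ W ∈ (Finset.univ : Finset (Finset (Fin n))).filter (fun W => Disjoint W A'),
              (prodBernoulli w').real
                  {ω : BondConfig (Fin n) | ∀ z : Fin n, (z ∈ W ↔ ω ∈ ⋃ v ∈ S', openConn v z)}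
                * A'.inf' ⟨b', hb'⟩ (fun a => (prodBernoulli w').real (openConnIn ((W : Set (Fin n))ᶜ) a b'))) :=
      fun w' hw' => hblk w' (lt_of_lt_of_le hw' (edgeSw_card_posDeg_le u s(x, y)))
    exact blockGood_of_edgeSwitch u A S b a₀ dd x y hb hSA hx hyS hddmin hle
      (fun S' hS'A => ih _ hlt (Function.update u s(x, y) 0) rfl A S' b dd hb hS'A hdd hddmin hblk0)
  -- the residual class: use the certificate
  have hbad : ∀ v ∈ S, (prodBernoulli u).real (openConn v b) < (prodBernoulli u).real (openConn a₀ b) := by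
    intro v hv
    by_contra h
    exact hleaf ⟨v, hv, not_lt.1 h⟩
  have hpbad : ∀ v ∈ S, (prodBernoulli (fun e : Sym2 (Fin n) => if a₀ ∈ e ∧ (∃ y ∈ e, y ∈ S) then (0 : unitInterval) else u e)).real (openConn v b) < (prodBernoulli (fun e : Sym2 (Fin n) => if a₀ ∈ e ∧ (∃ y ∈ e, y ∈ S) then (0 : unitInterval) else u e)).real (openConn a₀ b) := by
    intro v hv
    by_contra h
    exact hpleaf ⟨v, hv, not_lt.1 h⟩
  have hgdm : ∀ x' ∈ S, (∃ y : Fin n, (u s(x', y) : ℝ) ≠ 0) → ∀ dd ∈ A,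
      (∀ a ∈ A, (prodBernoulli (fun e : Sym2 (Fin n) => if (∃ y ∈ e, y ∈ ({x'} : Finset (Fin n))) then (0 : unitInterval) else u e)).real (openConn dd b) ≤ (prodBernoulli (fun e : Sym2 (Fin n) => if (∃ y ∈ e, y ∈ ({x'} : Finset (Fin n))) then (0 : unitInterval) else u e)).real (openConn a b)) →
      (prodBernoulli (fun e : Sym2 (Fin n) => if (∀ y ∈ e, y ∈ S) ∧ ¬ e.IsDiag then 1 else u e)).real (openConn dd b) < (prodBernoulli (fun e : Sym2 (Fin n) => if (∀ y ∈ e, y ∈ S) ∧ ¬ e.IsDiag then 1 else u e)).real (openConn a₀ b) := by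
    intro x' hx' hy dd hdd hddmin
    by_contra h
    exact hsw ⟨x', hx', hy, dd, hdd, hddmin, not_lt.1 h⟩
  have hpgdm : ∀ x' ∈ S, (∃ y : Fin n, ((fun e : Sym2 (Fin n) => if a₀ ∈ e ∧ (∃ y ∈ e, y ∈ S) then (0 : unitInterval) else u e) s(x', y) : ℝ) ≠ 0) → ∀ dd ∈ A,
      (∀ a ∈ A, (prodBernoulli (fun e : Sym2 (Fin n) => if (∃ y ∈ e, y ∈ ({x'} : Finset (Fin n))) then (0 : unitInterval) else (fun e : Sym2 (Fin n) => if a₀ ∈ e ∧ (∃ y ∈ e, y ∈ S) then (0 : unitInterval) else u e) e)).real (openConn dd b) ≤ (prodBernoulli (fun e : Sym2 (Fin n) => if (∃ y ∈ e, y ∈ ({x'} : Finset (Fin n))) then (0 : unitInterval) else (fun e : Sym2 (Fin n) => if a₀ ∈ e ∧ (∃ y ∈ e, y ∈ S) then (0 : unitInterval) else u e) e)).real (openConn a b)) →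
      (prodBernoulli (fun e : Sym2 (Fin n) => if (∀ y ∈ e, y ∈ S) ∧ ¬ e.IsDiag then 1 else (fun e : Sym2 (Fin n) => if a₀ ∈ e ∧ (∃ y ∈ e, y ∈ S) then (0 : unitInterval) else u e) e)).real (openConn dd b) < (prodBernoulli (fun e : Sym2 (Fin n) => if (∀ y ∈ e, y ∈ S) ∧ ¬ e.IsDiag then 1 else (fun e : Sym2 (Fin n) => if a₀ ∈ e ∧ (∃ y ∈ e, y ∈ S) then (0 : unitInterval) else u e) e)).real (openConn a₀ b) := by
    intro x' hx' hy dd hdd hddmin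
    by_contra h
    exact hpsw ⟨x', hx', hy, dd, hdd, hddmin, not_lt.1 h⟩
  have hedge : ∀ x ∈ S, ∀ y : Fin n, y ∉ S → (u s(x, y) : ℝ) ≠ 0 → ∀ dd ∈ A,
      (∀ a ∈ A, (prodBernoulli (Function.update u s(x, y) 0)).real (openConn dd b) ≤ (prodBernoulli (Function.update u s(x, y) 0)).real (openConn a b)) →
      (prodBernoulli (fun e : Sym2 (Fin n) => if (∀ z ∈ e, z ∈ S) ∧ ¬ e.IsDiag then 1 else u e)).real (openConn dd b) < (prodBernoulli (fun e : Sym2 (Fin n) => if (∀ z ∈ e, z ∈ S) ∧ ¬ e.IsDiag then 1 else u e)).real (openConn a₀ b) := by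
    intro x hx y hyS hne dd hdd hddmin
    by_contra h
    exact hes ⟨x, hx, y, hyS, hne, dd, hdd, hddmin, not_lt.1 h⟩
  obtain ⟨a, ha, hV⟩ := hG n u A S b a₀ hb hSA ha₀ hmin hblk hA4 hex hbad hpbad hgdm hpgdm hedge
  exact blockGood_of_exchange u A S b a₀ a hb hSne (hmin a ha) hV

/-- **`AdditiveGluing` from the single-competitor exchange certificate on the refined GDM class cut down by the single-edge
switch** (crux statement unfolded; via the landed assembly `stub_cone7Assembly_c5`). [cite: KozmaNitzan2024, §3.2 pp. 12–14] -/
theorem additiveGluing_of_edgeCert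
    (hG : (∀ (n : ℕ) (u : Sym2 (Fin n) → unitInterval) (A S : Finset (Fin n)) (b a₀ : Fin n) (hb : b ∈ A),
      Disjoint S A → a₀ ∈ A →
      (∀ a ∈ A, (prodBernoulli u).real (openConn a₀ b) ≤ (prodBernoulli u).real (openConn a b)) →
      (∀ w' : Sym2 (Fin n) → unitInterval,
        (Finset.univ.filter (fun v : Fin n => ∃ y : Fin n, 0 < (w' s(y, v) : ℝ))).card
          < (Finset.univ.filter (fun v : Fin n => ∃ y : Fin n, 0 < (u s(y, v) : ℝ))).card →
        ∀ (A' S' : Finset (Fin n)) (b' d' : Fin n) (hb' : b' ∈ A'), Disjoint S' A' → d' ∈ A' →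
        (∀ a ∈ A', (prodBernoulli w').real (openConn d' b') ≤ (prodBernoulli w').real (openConn a b')) →
        (prodBernoulli w').real (openConn d' b')
          + (prodBernoulli w').real
              ((openConn d' b')ᶜ ∩ (⋃ v ∈ S', openConn d' v) ∩ (⋃ v ∈ S', openConn v b'))
        ≤ (prodBernoulli w').real (⋃ v ∈ S', openConn v b')
          + (∑ W ∈ (Finset.univ : Finset (Finset (Fin n))).filter (fun W => Disjoint W A'),
              (prodBernoulli w').real
                  {ω : BondConfig (Fin n) | ∀ z : Fin n, (z ∈ W ↔ ω ∈ ⋃ v ∈ S', openConn v z)}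
                * A'.inf' ⟨b', hb'⟩ (fun a => (prodBernoulli w').real (openConnIn ((W : Set (Fin n))ᶜ) a b')))) →
      4 ≤ A.card →
      (∃ x ∈ S, ∃ y : Fin n, (u s(x, y) : ℝ) ≠ 0) →
      (∀ v ∈ S, (prodBernoulli u).real (openConn v b) < (prodBernoulli u).real (openConn a₀ b)) →
      (∀ v ∈ S, (prodBernoulli (fun e : Sym2 (Fin n) => if a₀ ∈ e ∧ (∃ y ∈ e, y ∈ S) then (0 : unitInterval) else u e)).real (openConn v b) < (prodBernoulli (fun e : Sym2 (Fin n) => if a₀ ∈ e ∧ (∃ y ∈ e, y ∈ S) then (0 : unitInterval) else u e)).real (openConn a₀ b)) →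
      (∀ x' ∈ S, (∃ y : Fin n, (u s(x', y) : ℝ) ≠ 0) → ∀ dd ∈ A,
        (∀ a ∈ A, (prodBernoulli (fun e : Sym2 (Fin n) => if (∃ y ∈ e, y ∈ ({x'} : Finset (Fin n))) then (0 : unitInterval) else u e)).real (openConn dd b) ≤ (prodBernoulli (fun e : Sym2 (Fin n) => if (∃ y ∈ e, y ∈ ({x'} : Finset (Fin n))) then (0 : unitInterval) else u e)).real (openConn a b)) →
        (prodBernoulli (fun e : Sym2 (Fin n) => if (∀ y ∈ e, y ∈ S) ∧ ¬ e.IsDiag then 1 else u e)).real (openConn dd b) < (prodBernoulli (fun e : Sym2 (Fin n) => if (∀ y ∈ e, y ∈ S) ∧ ¬ e.IsDiag then 1 else u e)).real (openConn a₀ b)) →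
      (∀ x' ∈ S, (∃ y : Fin n, ((fun e : Sym2 (Fin n) => if a₀ ∈ e ∧ (∃ y ∈ e, y ∈ S) then (0 : unitInterval) else u e) s(x', y) : ℝ) ≠ 0) → ∀ dd ∈ A,
        (∀ a ∈ A, (prodBernoulli (fun e : Sym2 (Fin n) => if (∃ y ∈ e, y ∈ ({x'} : Finset (Fin n))) then (0 : unitInterval) else (fun e : Sym2 (Fin n) => if a₀ ∈ e ∧ (∃ y ∈ e, y ∈ S) then (0 : unitInterval) else u e) e)).real (openConn dd b) ≤ (prodBernoulli (fun e : Sym2 (Fin n) => if (∃ y ∈ e, y ∈ ({x'} : Finset (Fin n))) then (0 : unitInterval) else (fun e : Sym2 (Fin n) => if a₀ ∈ e ∧ (∃ y ∈ e, y ∈ S) then (0 : unitInterval) else u e) e)).real (openConn a b)) →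
        (prodBernoulli (fun e : Sym2 (Fin n) => if (∀ y ∈ e, y ∈ S) ∧ ¬ e.IsDiag then 1 else (fun e : Sym2 (Fin n) => if a₀ ∈ e ∧ (∃ y ∈ e, y ∈ S) then (0 : unitInterval) else u e) e)).real (openConn dd b) < (prodBernoulli (fun e : Sym2 (Fin n) => if (∀ y ∈ e, y ∈ S) ∧ ¬ e.IsDiag then 1 else (fun e : Sym2 (Fin n) => if a₀ ∈ e ∧ (∃ y ∈ e, y ∈ S) then (0 : unitInterval) else u e) e)).real (openConn a₀ b)) →
      -- NEW: every single-edge switch fails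
      (∀ x ∈ S, ∀ y : Fin n, y ∉ S → (u s(x, y) : ℝ) ≠ 0 → ∀ dd ∈ A,
        (∀ a ∈ A, (prodBernoulli (Function.update u s(x, y) 0)).real (openConn dd b) ≤ (prodBernoulli (Function.update u s(x, y) 0)).real (openConn a b)) →
        (prodBernoulli (fun e : Sym2 (Fin n) => if (∀ z ∈ e, z ∈ S) ∧ ¬ e.IsDiag then 1 else u e)).real (openConn dd b) < (prodBernoulli (fun e : Sym2 (Fin n) => if (∀ z ∈ e, z ∈ S) ∧ ¬ e.IsDiag then 1 else u e)).real (openConn a₀ b)) →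
      ∃ a ∈ A, (prodBernoulli u).real (openConn a b ∩ (⋃ s ∈ S, openConn a₀ s)ᶜ)
      ≤ (prodBernoulli u).real ((⋃ s ∈ S, openConn s b) ∩ (⋃ s ∈ S, openConn a₀ s)ᶜ)
        + ∑ W ∈ (Finset.univ : Finset (Finset (Fin n))).filter (fun W => Disjoint W A),
            (prodBernoulli u).real {ω : BondConfig (Fin n) | ∀ z : Fin n, (z ∈ W ↔ ω ∈ ⋃ s ∈ S, openConn s z)}
              * A.inf' ⟨b, hb⟩ (fun a' => (prodBernoulli u).real (openConnIn ((W : Set (Fin n))ᶜ) a' b)))) :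
    ∀ (n : ℕ) (w : Sym2 (Fin n) → unitInterval) (A : Finset (Fin n)) (o b : Fin n) (t : ℝ), 0 ≤ t →
      (∀ a ∈ A, 1 - t ≤ (prodBernoulli w).real (openConn a b)) →
      (prodBernoulli w).real (⋃ a ∈ A, openConn o a) - t ≤ (prodBernoulli w).real (openConn o b) :=
  stub_cone7Assembly_c5 (cone7_of_edgeCert hG)

end EdgeSwitchReduction

end

end Summit.CriticalPhenomena.PercolationContinuityZ3.Theorems
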